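import Summits.NavierStokesRegularity.FunctionalMining.CrossedShearPressure
import Summits.NavierStokesRegularity.FunctionalMining.GradPressureMomentRate
import HarnessLib

/-!
# FunctionalMining — kernel no-go: the pressure-gradient row `EP.gradp.q=2|T_LD|G1` is FALSE for every κ (W11)

Search for candidate a priori estimates; no regularity claim. Cell `pub-nsfunc`, prove seat
(gen 10). SIEVELD §2, Corollary W11 for the core `∫|∇p|²`: at the reciprocal crossed shear `u_β`
(`π_{u_β} = cc`, viscous source `A = −8π² h_β(x₂) cc`, `CrossedShearPressure`) the viscous rate of
`∫|∇π|²` (`gradPressureSqViscousRate v = −2∫π_v A_v`, `GradPressureMomentRate`) is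
`V(u_β) = 16π² ∫ h_β cc² = 16π⁴(β² − 2)`; at `β = 2` it is `32π⁴ > 0`, so Theorem H (`HeatSieve`)
kills `SaturatingLaw (∫|∇π|²) σ γ κ` for every `κ`, `σ`, `γ ≥ 0` — in particular the K0 row
`EP.gradp.q=2|T_LD|G1` (`σ = 3`, `γ = 7/3`). Explicit-witness no-go; nothing about regularity.
-/

noncomputable section

open MeasureTheory Set Filter Topology Real
open scoped InnerProductSpace ContDiff

namespace Summit.NavierStokesRegularity.FunctionalMining

open Literature.Analysis Literature.Analysis.FunctionSpaces Literature.Analysis.FunctionSpaces.Torus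
open Literature.Analysis.FluidPDE

namespace CrossedShear

/-- **`V(u_β) = 16π⁴(β² − 2)`** for the pressure-gradient moment at the crossed shear. [ours] -/
theorem gradPressureSqViscousRate_cshear (β : ℝ) :
    gradPressureSqViscousRate (cshear β) = 16 * π ^ 4 * (β ^ 2 - 2) := by
  unfold gradPressureSqViscousRate
  rw [pressureOf_cshear]
  simp only [pressureSqViscousSource_cshear]
  have e : ∀ x : UnitAddTorus (Fin 3), cc x * (-(8 * π ^ 2) * (heatProfile β (x 2) * cc x)) =
      -(8 * π ^ 2) * (heatProfile β (x 2) * cc x ^ 2) := by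
    intro x; ring
  simp_rw [e]
  rw [integral_const_mul, integral_mul_cc_sq, integral_circle_heatProfile]
  ring

/-- **Kernel no-go (SIEVELD §1–§2): `∫|∇p|²` obeys NO saturating law.** For every `κ`, every `σ` and
every `γ ≥ 0`, `SaturatingLaw (torusGradPressureMoment 2) σ γ κ` fails on `T³` (crossed shear `u₂`:
viscous initial rate `32π⁴ > 0`, Theorem H). In particular the K0 row `EP.gradp.q=2|T_LD|G1`
(`σ = 3`, `γ = 7/3`) is FALSE for every κ. Search for candidate a priori estimates; no regularity
claim. [ours; SIEVELD §1 Thm H, §2 Cor. W11] -/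
theorem not_saturatingLaw_gradPressureMoment_two {σ γ : ℝ} (hγ : 0 ≤ γ) (κ : ℝ) :
    ¬ SaturatingLaw (d := Fin 3) (torusGradPressureMoment 2) σ γ κ := by
  have hV : 0 < gradPressureSqViscousRate (cshear 2) := by
    rw [gradPressureSqViscousRate_cshear]
    have : (0 : ℝ) < π ^ 4 := by positivity
    nlinarith
  exact not_saturatingLaw_of_viscousRate_pos hasInitialRate_torusGradPressureMoment_two (by simp)
    (isSmooth_cshear 2) (isDivFree_cshear 2) (hasZeroMean_cshear 2) hV hγ κ

/-- **Row `EP.gradp.q=2|T_LD|G1` (K0: `σ_F = 3`, `γ_F = 7/3`) is FALSE for every κ.** [ours] -/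
theorem not_saturatingLaw_gradPressureMoment_two_row (κ : ℝ) :
    ¬ SaturatingLaw (d := Fin 3) (torusGradPressureMoment 2) 3 (7 / 3) κ :=
  not_saturatingLaw_gradPressureMoment_two (by norm_num) κ

end CrossedShear

end Summit.NavierStokesRegularity.FunctionalMining
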